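import Summits.RiemannHypothesis.RiemannHypothesis.Theorems.WeilCombCombShapePositivityPerronArchRows

/-!
# The Perron-gauge form of Bombieri's off-diagonal kernel: harmonic Toeplitz + Hilbert/Hankel
(crux `WeilComb.CombShapePositivity`, item stmt-RiemannHypothesis-11229, line `Sketch`; the algebraic step behind the
registered `stub_coerciveCoreClean`, the ζ-free core of the coercivity stub `stub_perpCoercivityTop` (plan B7))

For the unsmoothed archimedean off-diagonal kernel `g(t) = e^{t/2}/(2 sinh t)` (`…PerronArchRows.gker_log_ratio`:
`g(log(m/m′))/√m′ = m√m/(m² − m′²)`), dividing once more by `√m` puts the kernel in the gauge `b_m = √m·y_m` of the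
divisor-graph energy:

  `g(log m − log m′) / √(m m′) = ½ (1/(m − m′) + 1/(m + m′))`   (`0 < m′ < m`),

i.e. the matrix `[g(|log m − log m′|)/√(mm′)]_{m ≠ m′}` is one half of the HARMONIC TOEPLITZ matrix `1/|m − m′|` plus one half
of the HILBERT (Hankel) matrix `1/(m + m′)`. Consequently, on a top cell `ε = 1/(2(M+1))` the archimedean off-diagonal form of the
fixed-shape comb in the Perron gauge is `−(R/(4(M+1)))·Σ_{m≠m′} b_m b̄_{m′}(1/|m−m′| + 1/(m+m′))` up to the B1 smoothing, which is the
statement registered as `stub_coerciveCoreClean` (see `Cruxes/CombShapePositivity/NOTES-c3.md` §8).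
-/

noncomputable section

-- the sub-problem path `RiemannHypothesis/RiemannHypothesis` (single-conjunct summit, D-0017) duplicates a namespace
set_option linter.dupNamespace false

namespace Summit.RiemannHypothesis.RiemannHypothesis.Theorems.WeilCombBohrFejer

/-- **Perron gauge of Bombieri's kernel (`stub_gkerPerronGauge`, registered).** For naturals `0 < m′ < m`,
`e^{(log m − log m′)/2} / (2 sinh(log m − log m′)) / √(m m′) = (1/(m − m′) + 1/(m + m′))/2`: the off-diagonal
archimedean kernel against `(mm′)^{-1/2}` is half the harmonic Toeplitz kernel plus half the Hilbert–Hankel kernel. [folklore] -/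
theorem stub_gkerPerronGauge : ∀ (m m' : ℕ), 0 < m' → m' < m →
    Real.exp ((Real.log m - Real.log m') / 2) / (2 * Real.sinh (Real.log m - Real.log m')) /
        Real.sqrt ((m : ℝ) * m') =
      (1 / ((m : ℝ) - m') + 1 / ((m : ℝ) + m')) / 2 := by
  intro m m' hm' hlt
  have hm0 : (0 : ℝ) < m := by exact_mod_cast (hm'.trans hlt)
  have hm'0 : (0 : ℝ) < m' := by exact_mod_cast hm'
  have hlt' : (m' : ℝ) < m := by exact_mod_cast hlt
  have hsq : Real.sqrt ((m : ℝ) * m') = Real.sqrt m * Real.sqrt m' := Real.sqrt_mul hm0.le _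
  have hsm : 0 < Real.sqrt (m : ℝ) := Real.sqrt_pos.2 hm0
  have hsm' : 0 < Real.sqrt (m' : ℝ) := Real.sqrt_pos.2 hm'0
  have key := Summit.RiemannHypothesis.RiemannHypothesis.Theorems.WeilCombPerronArchRows.gker_log_ratio m m' hm' hlt
  -- `g/√m′ = m√m/(m² − m′²)`, so `g/(√m√m′) = m/(m² − m′²) = ½(1/(m−m′) + 1/(m+m′))`
  have e1 : Real.exp ((Real.log m - Real.log m') / 2) / (2 * Real.sinh (Real.log m - Real.log m')) /
      Real.sqrt ((m : ℝ) * m') =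
      (Real.exp ((Real.log m - Real.log m') / 2) / (2 * Real.sinh (Real.log m - Real.log m')) *
        (Real.sqrt (m' : ℝ))⁻¹) * (Real.sqrt (m : ℝ))⁻¹ := by
    rw [hsq]
    field_simp
  rw [e1, key]
  have hden : (m : ℝ) ^ 2 - (m' : ℝ) ^ 2 ≠ 0 := by
    have : (m' : ℝ) ^ 2 < (m : ℝ) ^ 2 := by nlinarith
    linarith
  have hsub : (m : ℝ) - m' ≠ 0 := by linarith
  have hadd : (m : ℝ) + m' ≠ 0 := by linarith
  have hmsq : Real.sqrt (m : ℝ) * Real.sqrt (m : ℝ) = m := Real.mul_self_sqrt hm0.le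
  field_simp
  nlinarith [hmsq]

end Summit.RiemannHypothesis.RiemannHypothesis.Theorems.WeilCombBohrFejer

end
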